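import Literature.NumberTheory.ComplexMultiplication.FiniteQAlgebraLatticeLocallyPrincipal
import HarnessLib

/-!
# LIFTING UNITS of `Λ_(p)/L_(p)` to `Λ_(p)^unit` (Hertling–Larabi 2026 Thm. 7.6 (b)) and the KERNEL of
# `G(Λ_2) → G(Λ_1)`, `L ↦ Λ_1L`, for orders `Λ_2 ⊆ Λ_1` of an ARBITRARY finite-dimensional commutative
# `ℚ`-algebra `A` (Hertling–Larabi 2026 Thm. 8.2 (b) Steps 2–4, (d)) — nilpotents allowed

[topic NumberTheory/ComplexMultiplication] General-`A` series (namespace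
`Literature.NumberTheory.ComplexMultiplication.FiniteQAlgebraLattice`), the general-`A` twin of the `Y = L_1 ⊕ ⋯ ⊕ L_t`
file `CMAlgebraLatticeOrderExtensionKernel` (seat p19 gen 32), whose semilocal proofs use nothing of `Y` beyond its
ring structure and the finiteness of `Λ/pΛ`; sequel of `FiniteQAlgebraLatticeLocallyPrincipal` (Thm. 7.3 «⇒»,
invertible ⟹ locally principal; Thm. 8.2 (b) Step 1) and `FiniteQAlgebraLatticeLocalUnits` («`a ∈ Λ_(p)^{unit}`» ⟺
«`a + pΛ ∈ (Λ/pΛ)^{unit}`», conductor).  Lane `lit-hodgefound` (Track 2 foundations library), seat p19 generation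
36, row g36-#9.  THEOREMS ONLY: no definition, no instance, no notation, no named fact (D-0026, net Literature debt
`0`), no `sorry`.

DEF-FREE SPELLING (continued from `FiniteQAlgebraLatticeLocalization` ∕ `…LocalUnits`).  «`L_1`, `L_2` agree at `p`» = `∃ s : ℤ, ¬ ↑p ∣ s ∧ sL_1 ⊆ L_2 ∧
sL_2 ⊆ L_1`; for `a ∈ Λ`: «`a ∈ Λ_(p)^{unit}`» = `∃ b ∈ Λ, ∃ r : ℤ, ¬ ↑p ∣ r ∧ a·b = r·1`, «`a + pΛ ∈ (Λ/pΛ)^{unit}`»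
= `∃ b ∈ Λ, ∃ c ∈ Λ, a·b = 1 + p·c`; for a `Λ`-ideal `L ⊆ Λ` and `a ∈ Λ`: «`a + L_(p) ∈ (Λ_(p)/L_(p))^{unit}`» =
`∃ b ∈ Λ, ∃ s : ℤ, ¬ ↑p ∣ s ∧ a·b − s·1 ∈ L`.

## Source, VERBATIM

C. Hertling, K. Larabi, *Semigroups from full lattices in commutative ℚ-algebras*, arXiv:2602.14973 (2026)
[HertlingLarabi2026], held `paper:arxiv-2602.14973`.  §7 (chunk p0019): «**Theorem 7.6.** Let `A` be as in
Theorem 3.1. Let `Λ` be an order, and let `L ⊂ Λ` be a `Λ`-ideal (not necessarily exact). […] (b) Fix `p ∈ P_0`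
and an element `a_1 ∈ Λ_(p)` with `a_1 + L_(p) ∈ (Λ_(p)/L_(p))^{unit}`. There is an element
`a_3 ∈ Λ ∩ Λ_(p)^{unit}` with `a_3 + L ∈ (Λ/L)^{unit}`, `a_3 + L_(p) = a_1 + L_(p)`, […]. Especially, the group
homomorphism `Λ_(p)^{unit} → (Λ_(p)/L_(p))^{unit}` is surjective. *Proof:* […] We want to find an element
`a_3 ∈ a_2 + L (⊂ Λ)` with `a_3 ∈ Λ_(p)^{unit}`. This is surprisingly nontrivial. We will use Lemma 7.5 (b) and the
quotient ring `Λ/pΛ`. We have to discuss its structure. […]»  §8 (chunks p0021–p0022): «**Theorem 8.2.** Let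
`Λ_1` and `Λ_2` be two orders in `A` with `Λ_2 ⊊ Λ_1`. The full lattice `C := Λ_2:Λ_1` is called conductor of
the pair `(Λ_1, Λ_2)`. […] (b) The following sequence is exact,
`1 → ∏_{p∈P_0}(Λ_2)_(p)^{unit} → ∏_{p∈P_0}(Λ_1)_(p)^{unit} → G(Λ_2) → G(Λ_1) → 1`. […] (d) The isomorphism of
groups `(Λ_1/C)^{unit}/(Λ_2/C)^{unit} → ker(G(Λ_2) → G(Λ_1))` which results from (b) and (c) is given by
`((a + C) mod (Λ_2/C)^{unit}) ↦ C + aΛ_2`, where `a ∈ Λ_1`, `a + C ∈ (Λ_1/C)^{unit} ⊂ Λ_1/C`. *Proof:* (b) […]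
Step 2: Given a tuple `(a_p)_{p∈P_0} ∈ ∏_{p∈P_0}(Λ_1)_(p)^{unit}`, define for each `p ∈ ℙ − P_0` `a_p := 1_A` and
consider the full lattice `L := ⋂_{p∈ℙ} a_p(Λ_2)_(p)` […]. By Theorem 7.3 `L ∈ G(Λ_2)`. Observe
`(Λ_1L)_(p) = a_p(Λ_1Λ_2)_(p) = a_p(Λ_1)_(p) = (Λ_1)_(p)` for each `p ∈ ℙ`. […] so
`L ∈ ker(G(Λ_2) → G(Λ_1))`. Step 3: Vice versa, consider a full lattice `L_3 ∈ ker(G(Λ_2) → G(Λ_1))`. […] For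
`p ∈ P_0` by Theorem 7.3 and by `L_3 ∈ G(Λ_2)` there exists `c_p ∈ A^{unit}` with `(L_3)_(p) = c_p(Λ_2)_(p)`. For
`p ∈ P_0` `(Λ_1)_(p) = (Λ_1L_3)_(p) = (Λ_1)_(p)c_p(Λ_2)_(p) = c_p(Λ_1)_(p)`, so `c_p ∈ (Λ_1)_(p)^{unit}`. […]
(d) […] By the proof of Theorem 7.6 (b) for each `p ∈ P_0` an element `d_p ∈ a + C ⊂ Λ_1` with
`d_p ∈ (Λ_1)_(p)^{unit}` exists. […] For `p ∈ P_0` write `a = d_p + f_p` for some `f_p ∈ C`. For `p ∈ P_0`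
`(C + aΛ_2)_(p) = (C + d_pΛ_2 + f_pΛ_2)_(p) = (C + d_pΛ_2)_(p) = C_(p) + d_p(Λ_2)_(p) = d_pC_(p) + d_p(Λ_2)_(p) =
d_p(C + Λ_2)_(p) = d_p(Λ_2)_(p)`. […] Therefore `L = ⋂_{p∈ℙ}(C + aΛ_2)_(p) = C + aΛ_2`.»

## The proof of Theorem 7.6 (b) formalised here

Not HL's route through the structure `Λ/pΛ = ⊕ A^{(j)}`, `A^{(j)} = F^{(j)} ⊕ N^{(j)}` of the finite
`𝔽_p`-algebra, but the semilocal device of `FiniteQAlgebraLatticeLocallyPrincipal`: the maximal ideals `𝔪` of `Λ` above `p` are finitely many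
(window finiteness); for those with `L ⊄ 𝔪` the `Λ`-module `L` maps ONTO `Λ/𝔪` (pick `z ∈ L ∖ 𝔪` and invert it
mod `𝔪`), so the Chinese remainder theorem inside `L` gives `l ∈ L` with `a + l ≡ 1 (mod 𝔪)` for all of them at
once; for those with `L ⊆ 𝔪` already `a ∉ 𝔪` (as `ab ≡ s·1 (mod L)` with `p ∤ s`, and `(p, s) = 1` would put `1`
in `𝔪`). Hence `a + l` lies in no maximal ideal above `p`, i.e. `(a + l)Λ + pΛ = Λ`, which is
«`(a + l) + pΛ ∈ (Λ/pΛ)^{unit}`», equivalently (`FiniteQAlgebraLatticeLocalUnits`, Lemma 7.5 (b)) `a + l ∈ Λ_(p)^{unit}`.  The `Λ`-ideal `L`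
need NOT be full for this.

## Contents

* §1 `locEq_sup` (Thm. 7.2 (a): `(L_1 + L_2)_(p) = (L_1)_(p) + (L_2)_(p)`).
* §2 THEOREM 7.6 (b): `exists_add_mem_mul_eq_one_add_smul` (a unit of `Λ_(p)/L_(p)` represented by `a ∈ Λ` has a
  representative `a + l`, `l ∈ L`, that is a unit mod `pΛ`), `exists_add_mem_mul_eq_smul_one` (… that lies in
  `Λ_(p)^{unit}`).
* §3 THEOREM 8.2 (b) Steps 2–4: for orders `Λ_2 ⊆ Λ_1` and `L ∈ G(Λ_2)`: `Λ_1L = Λ_1` iff `L_(p) = a_p(Λ_2)_(p)`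
  with `a_p ∈ Λ_1 ∩ (Λ_1)_(p)^{unit}` for every prime `p` (`order_mul_eq_iff_forall_prime_exists_localUnit_locEq`);
  every such family `(a_p)` (`a_p = 1` for almost all `p`) is realised by some `L ∈ ker` (Step 2,
  `exists_mem_ker_forall_prime_locEq`); and `(aΛ)_(p) = Λ_(p) ⟺ a ∈ Λ_(p)^{unit}` (Step 4,
  `locEq_units_smul_self_iff_exists_mul_eq_smul_one`).
* §4 THEOREM 8.2 (d) (8.6): for `a ∈ Λ_1` with `a + C ∈ (Λ_1/C)^{unit}`, `C = Λ_2:Λ_1` the conductor, the lattice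
  `C + aΛ_2` is a full lattice with exact order `Λ_2`, invertible, and `Λ_1(C + aΛ_2) = Λ_1`
  (`conductor_sup_map_mulLeft_mem_ker`), with local generators `d_p ∈ (a + C) ∩ (Λ_1)_(p)^{unit}`.

## References

* [HertlingLarabi2026] C. Hertling, K. Larabi, *Semigroups from full lattices in commutative ℚ-algebras*,
  arXiv:2602.14973 (2026), §7 Thm. 7.2 (a), Lemma 7.5 (b), Thm. 7.6 (b) (chunks p0018–p0020), §8 Thm. 8.2 (b)
  Steps 2–4, (d) (chunks p0021–p0022). [cite: HertlingLarabi2026, §7 Thm. 7.6 (b) and §8 Thm. 8.2 (b)(d), chunks p0019–p0022]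
* [Faddeev1965] D. K. Faddeev, Trudy Mat. Inst. Steklov 80 (1965) 145–182, as cited by HL §7 (localisations,
  Thm. 7.3). [cite: Faddeev1965, as cited by HertlingLarabi2026 §7]
* [NeukirchANT1999] J. Neukirch, *Algebraic Number Theory*, Springer (1999), Ch. I §12 (conductor; Prop. (12.9):
  the one-field exact sequence `1 → 𝒪^* → 𝒪_K^* → (𝒪_K/𝔣)^*/(𝒪/𝔣)^* → Pic(𝒪) → Pic(𝒪_K) → 1`, which Thm. 8.2
  generalises). [cite: NeukirchANT1999, Ch. I §12 Prop. (12.9)]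
-/

noncomputable section

open scoped Pointwise
open Module Function

open Literature.NumberTheory.Automorphic (IsFullLattice mem_units_smul_submodule_iff finite_setOf_le_and_smul_mem)

namespace Literature.NumberTheory.ComplexMultiplication.FiniteQAlgebraLattice

section OrderExtensionKernel

variable {A : Type} [CommRing A] [Algebra ℚ A]

/-! ## §1 Theorem 7.2 (a): `(L_1 + L_2)_(p) = (L_1)_(p) + (L_2)_(p)` -/

omit [Algebra ℚ A] in
/-- **THEOREM 7.2 (a): agreement at `p` is compatible with SUMS**, `(L_1 + L_2)_(p) = (L_1)_(p) + (L_2)_(p)`.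
[cite: HertlingLarabi2026, §7 Thm. 7.2 (a), chunk p0018] -/
theorem locEq_sup {p : ℕ} (hp : p.Prime) {M M' N N' : Submodule ℤ A}
    (hM : ∃ s : ℤ, ¬ (p : ℤ) ∣ s ∧ (∀ x ∈ M, s • x ∈ M') ∧ (∀ x ∈ M', s • x ∈ M))
    (hN : ∃ s : ℤ, ¬ (p : ℤ) ∣ s ∧ (∀ x ∈ N, s • x ∈ N') ∧ (∀ x ∈ N', s • x ∈ N)) :
    ∃ s : ℤ, ¬ (p : ℤ) ∣ s ∧ (∀ x ∈ M ⊔ N, s • x ∈ M' ⊔ N') ∧ (∀ x ∈ M' ⊔ N', s • x ∈ M ⊔ N) := by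
  obtain ⟨s, hs, h₁, h₂⟩ := hM
  obtain ⟨s', hs', h₃, h₄⟩ := hN
  have hp' : Prime (p : ℤ) := Nat.prime_iff_prime_int.1 hp
  refine ⟨s * s', fun h => (hp'.dvd_or_dvd h).elim hs hs', fun x hx => ?_, fun x hx => ?_⟩
  · obtain ⟨m, hm, n, hn, rfl⟩ := Submodule.mem_sup.1 hx
    rw [smul_add, mul_comm s s', mul_smul, mul_smul]
    exact Submodule.add_mem_sup (Submodule.smul_mem _ _ (h₁ m hm))
      (by rw [← mul_smul, mul_comm, mul_smul]; exact Submodule.smul_mem _ _ (h₃ n hn))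
  · obtain ⟨m, hm, n, hn, rfl⟩ := Submodule.mem_sup.1 hx
    rw [smul_add, mul_comm s s', mul_smul, mul_smul]
    exact Submodule.add_mem_sup (Submodule.smul_mem _ _ (h₂ m hm))
      (by rw [← mul_smul, mul_comm, mul_smul]; exact Submodule.smul_mem _ _ (h₄ n hn))

/-! ## §2 Theorem 7.6 (b): units of `Λ_(p)/L_(p)` lift to `Λ_(p)^{unit}` -/

/-- **THEOREM 7.6 (b) (the «surprisingly nontrivial» step): for an order `Λ ⊂ Y`, a `Λ`-ideal `L ⊆ Λ` (`ΛL ⊆ L`, not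
necessarily full), a prime `p` and `a ∈ Λ` whose class is a unit of `Λ_(p)/L_(p)` (`ab − s·1 ∈ L` for some `b ∈ Λ`,
`p ∤ s`), there is `l ∈ L` such that `a + l` is a unit modulo `pΛ`: `(a + l)b' = 1 + pc` with `b', c ∈ Λ`** — so
(Lemma 7.5 (b)) `a + l ∈ Λ ∩ Λ_(p)^{unit}`, cf. `exists_add_mem_mul_eq_smul_one`. Semilocal Chinese-remainder proof
over the finitely many maximal ideals of `Λ` above `p` (module docstring), replacing HL's structure theory of `Λ/pΛ`.
[cite: HertlingLarabi2026, §7 Thm. 7.6 (b) («There is an element a_3 ∈ Λ ∩ Λ_(p)^unit with … a_3 + L_(p) = a_1 + L_(p)»; «Especially, the group homomorphism Λ_(p)^unit → (Λ_(p)/L_(p))^unit is surjective»), chunks p0019–p0020] -/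
theorem exists_add_mem_mul_eq_one_add_smul {Λ M : Submodule ℤ A} (hΛ : IsFullLattice A Λ)
    (h1 : (1 : A) ∈ Λ) (hΛΛ : Λ * Λ ≤ Λ) (hMΛ : M ≤ Λ) (hΛM : Λ * M ≤ M) {p : ℕ} (hp : p.Prime)
    {a b : A} (ha : a ∈ Λ) (hb : b ∈ Λ) {s : ℤ} (hs : ¬ (p : ℤ) ∣ s)
    (hab : a * b - s • (1 : A) ∈ M) :
    ∃ l ∈ M, ∃ b' ∈ Λ, ∃ c ∈ Λ, (a + l) * b' = 1 + (p : ℤ) • c := by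
  classical
  -- the commutative ring `S = Λ`; an ideal `𝔪 ⊆ S` seen inside `A` (as in `FiniteQAlgebraLatticeLocallyPrincipal` §1)
  let S : Subring A :=
    { carrier := ((Λ : Submodule ℤ A) : Set A)
      mul_mem' := fun ha hb => hΛΛ (Submodule.mul_mem_mul ha hb)
      one_mem' := h1
      add_mem' := fun ha hb => Λ.add_mem ha hb
      zero_mem' := Λ.zero_mem
      neg_mem' := fun ha => Λ.neg_mem ha }
  let g : Ideal S → Submodule ℤ A := fun 𝔪 =>
    AddSubgroup.toIntSubmodule ((Submodule.toAddSubgroup 𝔪).map (S.subtype : S →+* A).toAddMonoidHom)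
  have hg' : ∀ (𝔪 : Ideal S) (z : A), z ∈ g 𝔪 ↔ ∃ s ∈ 𝔪, (s : A) = z := fun 𝔪 z => by
    rw [← SetLike.mem_coe, AddSubgroup.coe_toIntSubmodule, SetLike.mem_coe, AddSubgroup.mem_map]
    simp only [Submodule.mem_toAddSubgroup, RingHom.toAddMonoidHom_eq_coe, AddMonoidHom.coe_coe,
      Subring.subtype_apply]
  have hg : ∀ (𝔪 : Ideal S) (s : S), (s : A) ∈ g 𝔪 ↔ s ∈ 𝔪 := fun 𝔪 s => by
    rw [hg']
    exact ⟨fun ⟨s', hs', h⟩ => Subtype.ext h ▸ hs', fun h => ⟨s, h, rfl⟩⟩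
  have hgΛ : ∀ (𝔪 : Ideal S), g 𝔪 ≤ Λ := fun 𝔪 z hz => by
    obtain ⟨s, -, rfl⟩ := (hg' 𝔪 z).1 hz
    exact s.2
  have hgmul : ∀ (𝔪 : Ideal S) {y x : A}, y ∈ Λ → x ∈ g 𝔪 → y * x ∈ g 𝔪 := fun 𝔪 y x hy hx => by
    obtain ⟨s', hs', rfl⟩ := (hg' 𝔪 x).1 hx
    have h := (hg 𝔪 (⟨y, hy⟩ * s')).2 (Ideal.mul_mem_left _ _ hs')
    simpa using h
  -- the maximal ideals of `S` above `p` are finitely many (additive groups between `pΛ` and `Λ`)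
  haveI : IsAddTorsionFree A := IsAddTorsionFree.of_isTorsionFree ℚ A
  have hfin : {𝔪 : Ideal S | 𝔪.IsMaximal ∧ (p : S) ∈ 𝔪}.Finite := by
    have hW := finite_setOf_le_and_smul_mem Λ hΛ.1 (n := (p : ℤ)) (Int.natCast_ne_zero.2 hp.ne_zero)
    refine Set.Finite.of_finite_image (f := g) (hW.subset ?_) fun 𝔪 _ 𝔪' _ h => ?_
    · rintro _ ⟨𝔪, ⟨-, hp𝔪⟩, rfl⟩
      refine ⟨hgΛ 𝔪, fun z hz => ?_⟩
      have h2 := (hg 𝔪 _).2 (Ideal.mul_mem_right (⟨z, hz⟩ : S) _ hp𝔪)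
      rw [zsmul_eq_mul, Int.cast_natCast]
      simpa using h2
    · ext s
      rw [← hg 𝔪 s, ← hg 𝔪' s, h]
  haveI : Finite {𝔪 : Ideal S // 𝔪.IsMaximal ∧ (p : S) ∈ 𝔪} := hfin.to_subtype
  letI : Fintype {𝔪 : Ideal S // 𝔪.IsMaximal ∧ (p : S) ∈ 𝔪} := Fintype.ofFinite _
  -- `(p, s) = 1`: `s·1` lies in no maximal ideal above `p`
  have hcop : IsCoprime (p : ℤ) s := by
    have hn : ¬ p ∣ s.natAbs := fun h => hs (Int.natCast_dvd.2 h)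
    have h0 := (hp.coprime_iff_not_dvd.mpr hn).isCoprime
    rcases Int.natAbs_eq s with h | h
    · rwa [← h] at h0
    · have h' : (s.natAbs : ℤ) = -s := by omega
      have h0' := h0.neg_right
      rwa [h', neg_neg] at h0'
  have hs1 : ∀ 𝔪 : {𝔪 : Ideal S // 𝔪.IsMaximal ∧ (p : S) ∈ 𝔪}, s • (1 : A) ∉ g 𝔪 := by
    intro 𝔪 hmem
    obtain ⟨u, v, huv⟩ := hcop
    refine 𝔪.2.1.ne_top ((Ideal.eq_top_iff_one _).2 ?_)
    have hsS : ((s : S) : A) ∈ g 𝔪 := by rwa [SubringClass.coe_intCast, ← Int.smul_one_eq_cast]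
    have h1S : (1 : S) = (u : S) * (p : S) + (v : S) * (s : S) := by
      have h := congrArg (fun z : ℤ => (z : S)) huv
      push_cast at h
      exact h.symm
    rw [h1S]
    exact (𝔪 : Ideal S).add_mem (Ideal.mul_mem_left _ _ 𝔪.2.2) (Ideal.mul_mem_left _ _ ((hg _ _).1 hsS))
  -- for `𝔪 ⊉ L`: `z_𝔪 ∈ L ∖ 𝔪` with an inverse `w_𝔪` mod `𝔪`; for `𝔪 ⊇ L`: `z_𝔪 = 0`
  have hz : ∀ 𝔪 : {𝔪 : Ideal S // 𝔪.IsMaximal ∧ (p : S) ∈ 𝔪}, ∃ z ∈ M, ∃ w : S,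
      M ≤ g 𝔪 ∨ (w : A) * z - 1 ∈ g 𝔪 := by
    intro 𝔪
    by_cases hMle : M ≤ g 𝔪
    · exact ⟨0, M.zero_mem, 0, Or.inl hMle⟩
    · obtain ⟨z, hzM, hz𝔪⟩ := Set.not_subset.1 hMle
      obtain ⟨w, i, hi, hwi⟩ := 𝔪.2.1.exists_inv (x := ⟨z, hMΛ hzM⟩) (fun h => hz𝔪 ((hg _ _).2 h))
      refine ⟨z, hzM, w, Or.inr ?_⟩
      have h : (w : A) * z + (i : A) = 1 := by
        have h := congrArg (fun x : S => (x : A)) hwi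
        simpa using h
      have e : (w : A) * z - 1 = -(i : A) := by linear_combination h
      rw [e]
      exact (g 𝔪).neg_mem ((hg _ _).2 hi)
  choose z hzM w hzw using hz
  -- Chinese remainder: `e_𝔪 ≡ 1 (mod 𝔪)`, `e_𝔪 ≡ 0 (mod 𝔪')` for `𝔪' ≠ 𝔪`
  have hcopI : Pairwise (IsCoprime on fun 𝔪 : {𝔪 : Ideal S // 𝔪.IsMaximal ∧ (p : S) ∈ 𝔪} => (𝔪 : Ideal S)) :=
    fun 𝔪 𝔪' hne => (Ideal.isCoprime_iff_sup_eq).2 (𝔪.2.1.coprime_of_ne 𝔪'.2.1 fun h => hne (Subtype.ext h))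
  have he : ∀ 𝔪 : {𝔪 : Ideal S // 𝔪.IsMaximal ∧ (p : S) ∈ 𝔪}, ∃ e : S, e - 1 ∈ (𝔪 : Ideal S) ∧
      ∀ 𝔪' : {𝔪 : Ideal S // 𝔪.IsMaximal ∧ (p : S) ∈ 𝔪}, 𝔪' ≠ 𝔪 → e ∈ (𝔪' : Ideal S) := by
    intro 𝔪
    obtain ⟨r, hr⟩ := Ideal.pi_quotient_surjective hcopI (Pi.single 𝔪 1)
    refine ⟨r, ?_, fun 𝔪' hne => ?_⟩
    · have h := hr 𝔪
      rw [Pi.single_eq_same] at h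
      exact Ideal.Quotient.eq.1 (h.trans (map_one _).symm)
    · have h := hr 𝔪'
      rw [Pi.single_eq_of_ne hne] at h
      exact Ideal.Quotient.eq_zero_iff_mem.1 h
  choose e he1 he0 using he
  -- `l := Σ e_𝔪 (1 − a) w_𝔪 z_𝔪 ∈ L`
  set l : A := ∑ 𝔪, (e 𝔪 : A) * ((1 - a) * ((w 𝔪 : A) * z 𝔪)) with hl_def
  have hcoef : ∀ 𝔪 : {𝔪 : Ideal S // 𝔪.IsMaximal ∧ (p : S) ∈ 𝔪},
      (1 - a) * ((w 𝔪 : A) * z 𝔪) ∈ M := fun 𝔪 => by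
    rw [← mul_assoc]
    exact hΛM (Submodule.mul_mem_mul (hΛΛ (Submodule.mul_mem_mul (Λ.sub_mem h1 ha) (w 𝔪).2)) (hzM 𝔪))
  have hlM : l ∈ M := M.sum_mem fun 𝔪 _ => hΛM (Submodule.mul_mem_mul (e 𝔪).2 (hcoef 𝔪))
  -- `a + l` lies in no maximal ideal above `p`
  have hal : ∀ 𝔪 : {𝔪 : Ideal S // 𝔪.IsMaximal ∧ (p : S) ∈ 𝔪}, a + l ∉ g 𝔪 := by
    intro 𝔪 hmem
    rcases hzw 𝔪 with hMle | hinv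
    · -- `L ⊆ 𝔪`: then `a ∈ 𝔪`, `ab ∈ 𝔪`, and `s·1 = ab − (ab − s·1) ∈ 𝔪`
      have haz : a ∈ g 𝔪 := by
        have h := (g 𝔪).sub_mem hmem (hMle hlM)
        rwa [add_sub_cancel_right] at h
      have hab' : a * b ∈ g 𝔪 := by rw [mul_comm]; exact hgmul _ hb haz
      have h := (g 𝔪).sub_mem hab' (hMle hab)
      rw [sub_sub_cancel] at h
      exact hs1 𝔪 h
    · -- `L ⊄ 𝔪`: `a + l ≡ a + (1 − a)w_𝔪z_𝔪 ≡ 1 (mod 𝔪)`, so `1 ∈ 𝔪`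
      have hsplit : a + l - 1 = (1 - a) * ((w 𝔪 : A) * z 𝔪 - 1) +
          ((e 𝔪 : A) - 1) * ((1 - a) * ((w 𝔪 : A) * z 𝔪)) +
          ∑ 𝔪' ∈ Finset.univ.erase 𝔪, (e 𝔪' : A) * ((1 - a) * ((w 𝔪' : A) * z 𝔪')) := by
        rw [hl_def, ← Finset.add_sum_erase _ _ (Finset.mem_univ 𝔪)]
        ring
      have hdiff : a + l - 1 ∈ g 𝔪 := by
        rw [hsplit]
        refine add_mem (add_mem (hgmul _ (Λ.sub_mem h1 ha) hinv) ?_) (Submodule.sum_mem _ fun 𝔪' h𝔪' => ?_)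
        · rw [mul_comm]
          refine hgmul _ (hMΛ (hcoef 𝔪)) ?_
          have h := (hg 𝔪 (e 𝔪 - 1)).2 (he1 𝔪)
          simpa using h
        · rw [mul_comm]
          exact hgmul _ (hMΛ (hcoef 𝔪')) ((hg 𝔪 (e 𝔪')).2 (he0 𝔪' 𝔪 (Finset.ne_of_mem_erase h𝔪').symm))
      have h := (g 𝔪).sub_mem hmem hdiff
      rw [sub_sub_cancel] at h
      exact 𝔪.2.1.ne_top ((Ideal.eq_top_iff_one _).2 ((hg _ _).1 h))
  -- hence `(a + l)S + pS = S`
  have haΛ : a + l ∈ Λ := Λ.add_mem ha (hMΛ hlM)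
  have hI : Ideal.span {(⟨a + l, haΛ⟩ : S)} ⊔ Ideal.span {(p : S)} = ⊤ := by
    by_contra hne
    obtain ⟨𝔪₀, h𝔪₀, hle⟩ := Ideal.exists_le_maximal _ hne
    have hp𝔪₀ : (p : S) ∈ 𝔪₀ := hle (Ideal.mem_sup_right (Ideal.mem_span_singleton_self _))
    have hw : (⟨a + l, haΛ⟩ : S) ∈ 𝔪₀ := hle (Ideal.mem_sup_left (Ideal.mem_span_singleton_self _))
    exact hal ⟨𝔪₀, h𝔪₀, hp𝔪₀⟩ ((hg _ _).2 hw)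
  obtain ⟨u, hu, v, hv, huv⟩ := Submodule.mem_sup.1 ((Ideal.eq_top_iff_one _).1 hI)
  obtain ⟨b', hb'⟩ := Ideal.mem_span_singleton'.1 hu
  obtain ⟨d, hd⟩ := Ideal.mem_span_singleton'.1 hv
  refine ⟨l, hlM, b', b'.2, -d, Λ.neg_mem d.2, ?_⟩
  have huv' : ((u : S) : A) + (v : A) = 1 := by rw [← Subring.coe_add, huv]; rfl
  have hu' : ((u : S) : A) = (b' : A) * (a + l) := by rw [← hb']; rfl
  have hv' : ((v : S) : A) = (d : A) * p := by rw [← hd, Subring.coe_mul, Subring.coe_natCast]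
  rw [hu', hv'] at huv'
  rw [zsmul_eq_mul, Int.cast_natCast]
  linear_combination huv'

/-- **THEOREM 7.6 (b): every unit of `Λ_(p)/L_(p)` represented by `a ∈ Λ` LIFTS to `a + l ∈ Λ ∩ Λ_(p)^{unit}` with
`l ∈ L`** — `(a + l)b' = r·1` with `b' ∈ Λ`, `p ∤ r` («the group homomorphism `Λ_(p)^{unit} → (Λ_(p)/L_(p))^{unit}`
is surjective»; by `exists_add_mem_mul_eq_one_add_smul` and Lemma 7.5 (b) ⇐ = `FiniteQAlgebraLatticeLocalUnits`
`exists_mem_mul_eq_smul_one_of_mul_eq_one_add`). [cite: HertlingLarabi2026, §7 Thm. 7.6 (b), chunks p0019–p0020] -/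
theorem exists_add_mem_mul_eq_smul_one {Λ M : Submodule ℤ A} (hΛ : IsFullLattice A Λ)
    (h1 : (1 : A) ∈ Λ) (hΛΛ : Λ * Λ ≤ Λ) (hMΛ : M ≤ Λ) (hΛM : Λ * M ≤ M) {p : ℕ} (hp : p.Prime)
    {a b : A} (ha : a ∈ Λ) (hb : b ∈ Λ) {s : ℤ} (hs : ¬ (p : ℤ) ∣ s)
    (hab : a * b - s • (1 : A) ∈ M) :
    ∃ l ∈ M, ∃ b' ∈ Λ, ∃ r : ℤ, ¬ (p : ℤ) ∣ r ∧ (a + l) * b' = r • (1 : A) := by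
  obtain ⟨l, hl, b', hb', c, hc, h⟩ := exists_add_mem_mul_eq_one_add_smul hΛ h1 hΛΛ hMΛ hΛM hp ha hb hs hab
  obtain ⟨b'', hb'', r, hr, h'⟩ := exists_mem_mul_eq_smul_one_of_mul_eq_one_add hΛ h1 hΛΛ hp hb' hc h
  exact ⟨l, hl, b'', hb'', r, hr, h'⟩

/-! ## §3 Theorem 8.2 (b) Steps 2–3: the kernel of `G(Λ_2) → G(Λ_1)`, `L ↦ Λ_1L` -/

omit [Algebra ℚ A] in
/-- If `Λ_(p) = (aΛ)_(p)` for a unit `a` of `A` and `1 ∈ Λ`, then `a·b = r·1` for some `b ∈ Λ`, `p ∤ r` — for `a ∈ Λ`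
this says `a ∈ Λ_(p)^{unit}` («`a_p(Λ_2)_(p) = (Λ_2)_(p)` is equivalent to `a_p ∈ (Λ_2)_(p)^{unit}`»).
[cite: HertlingLarabi2026, §8 Thm. 8.2 (b) proof Step 3–Step 4, chunk p0022] -/
theorem exists_mem_mul_eq_smul_one_of_locEq_units_smul {Λ : Submodule ℤ A} (h1 : (1 : A) ∈ Λ)
    (a : Aˣ) {p : ℕ}
    (h : ∃ s : ℤ, ¬ (p : ℤ) ∣ s ∧ (∀ x ∈ Λ, s • x ∈ a • Λ) ∧ (∀ x ∈ a • Λ, s • x ∈ Λ)) :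
    ∃ b ∈ Λ, ∃ r : ℤ, ¬ (p : ℤ) ∣ r ∧ (a : A) * b = r • (1 : A) := by
  obtain ⟨s, hs, h₁, -⟩ := h
  have h2 := h₁ 1 h1
  rw [mem_units_smul_submodule_iff] at h2
  exact ⟨_, h2, s, hs, by rw [Units.smul_def, smul_eq_mul, Units.mul_inv_cancel_left]⟩

omit [Algebra ℚ A] in
/-- **THEOREM 8.2 (b), Step 4: for a unit `a` of `A` lying in the order `Λ`, `(aΛ)_(p) = Λ_(p)` iff
`a ∈ Λ_(p)^{unit}`** («The kernel of the map `∏(Λ_1)_(p)^{unit} → G(Λ_2)` is `∏(Λ_2)_(p)^{unit}` because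
`a_p(Λ_2)_(p) = (Λ_2)_(p)` is equivalent to `a_p ∈ (Λ_2)_(p)^{unit}`»; «⇐» is `FiniteQAlgebraLatticeLocalUnits`'
`locEq_units_smul_of_mul_eq_smul_one`). [cite: HertlingLarabi2026, §8 Thm. 8.2 (b) proof Step 4, chunk p0022] -/
theorem locEq_units_smul_self_iff_exists_mul_eq_smul_one {Λ : Submodule ℤ A} (h1 : (1 : A) ∈ Λ)
    (hΛΛ : Λ * Λ ≤ Λ) (a : Aˣ) (ha : (a : A) ∈ Λ) {p : ℕ} :
    (∃ s : ℤ, ¬ (p : ℤ) ∣ s ∧ (∀ x ∈ Λ, s • x ∈ a • Λ) ∧ (∀ x ∈ a • Λ, s • x ∈ Λ)) ↔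
      ∃ b ∈ Λ, ∃ r : ℤ, ¬ (p : ℤ) ∣ r ∧ (a : A) * b = r • (1 : A) := by
  refine ⟨exists_mem_mul_eq_smul_one_of_locEq_units_smul h1 a, fun ⟨b, hb, r, hr, hab⟩ => ?_⟩
  have h := locEq_units_smul_of_mul_eq_smul_one hΛΛ ha hb hr hab (Units.isUnit a)
  have hu : (Units.isUnit a).unit = a := Units.ext (IsUnit.unit_spec _)
  rwa [hu] at h

/-- **THEOREM 8.2 (b), Steps 2–3: the KERNEL of `G(Λ_2) → G(Λ_1)`, `L ↦ Λ_1L`** — for orders `Λ_2 ⊆ Λ_1` of `A`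
and `L ∈ G(Λ_2)` (full, exact order `Λ_2`, invertible): `Λ_1L = Λ_1` iff for every prime `p`,
`L_(p) = a_p(Λ_2)_(p)` for some `a_p ∈ Λ_1 ∩ (Λ_1)_(p)^{unit}` («⇒»: `(L)_(p) = c_p(Λ_2)_(p)` by Thm. 7.3, and
`(Λ_1)_(p) = (Λ_1L)_(p) = c_p(Λ_1)_(p)`, so `c_p ∈ (Λ_1)_(p)^{unit}`, here with `c_p ∈ L ⊆ Λ_1L = Λ_1`; «⇐»:
`(Λ_1L)_(p) = a_p(Λ_1Λ_2)_(p) = a_p(Λ_1)_(p) = (Λ_1)_(p)`).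
[cite: HertlingLarabi2026, §8 Thm. 8.2 (b) («the following sequence is exact»), proof Steps 2–3, chunks p0021–p0022]
[cite: NeukirchANT1999, I §12 Prop. (12.9) (one field: `ker(Pic(𝒪) → Pic(𝒪_K))` comes from `⊕_𝔭 𝒪_{K,𝔭}^*/𝒪_𝔭^*`)] -/
theorem order_mul_eq_iff_forall_prime_exists_localUnit_locEq {Λ₁ Λ₂ M : Submodule ℤ A}
    (h1 : (1 : A) ∈ Λ₁) (hΛ₁Λ₁ : Λ₁ * Λ₁ ≤ Λ₁) (h2 : (1 : A) ∈ Λ₂) (hle : Λ₂ ≤ Λ₁)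
    (hM : IsFullLattice A M) (hO : M / M = Λ₂) (hinv : M * ((M / M) / M) = M / M) :
    Λ₁ * M = Λ₁ ↔ ∀ p : ℕ, p.Prime → ∃ a : Aˣ, (a : A) ∈ Λ₁ ∧
      (∃ b ∈ Λ₁, ∃ r : ℤ, ¬ (p : ℤ) ∣ r ∧ (a : A) * b = r • (1 : A)) ∧
      ∃ s : ℤ, ¬ (p : ℤ) ∣ s ∧ (∀ x ∈ M, s • x ∈ a • Λ₂) ∧ (∀ x ∈ a • Λ₂, s • x ∈ M) := by
  have hΛ₁Λ₂ : Λ₁ * Λ₂ = Λ₁ := order_mul_order_eq_of_le hΛ₁Λ₁ h2 hle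
  have hmul : ∀ a : Aˣ, Λ₁ * (a • Λ₂) = a • Λ₁ := fun a => by
    rw [mul_comm, ← units_smul_mul, mul_comm, hΛ₁Λ₂]
  constructor
  · intro hker p hp
    obtain ⟨a, haM, -, hloc⟩ := exists_units_mem_locEq_smul_of_mul_div_div_eq hM hinv hp
    rw [hO] at hloc
    have haΛ₁ : (a : A) ∈ Λ₁ := by
      rw [← hker, ← one_mul (a : A)]
      exact Submodule.mul_mem_mul h1 haM
    have h := locEq_mul hp (locEq_refl hp Λ₁) hloc
    rw [hker, hmul] at h
    exact ⟨a, haΛ₁, exists_mem_mul_eq_smul_one_of_locEq_units_smul h1 a h, hloc⟩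
  · intro h
    refine eq_of_forall_prime_locEq fun p hp => ?_
    obtain ⟨a, haΛ₁, ⟨b, hb, r, hr, hab⟩, hloc⟩ := h p hp
    have h₁ := locEq_mul hp (locEq_refl hp Λ₁) hloc
    rw [hmul] at h₁
    have h₂ := locEq_units_smul_of_mul_eq_smul_one hΛ₁Λ₁ haΛ₁ hb hr hab (Units.isUnit a)
    have hu : (Units.isUnit a).unit = a := Units.ext (IsUnit.unit_spec _)
    rw [hu] at h₂
    exact locEq_trans hp h₁ (locEq_symm h₂)

/-- **THEOREM 8.2 (b), Step 2: every family `a_p ∈ Λ_1 ∩ (Λ_1)_(p)^{unit}` (`a_p = 1` for almost all `p`) is the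
family of local generators of some `L ∈ ker(G(Λ_2) → G(Λ_1))`** — the glued lattice `L = ⋂_p a_p(Λ_2)_(p)` is full,
has exact order `Λ_2`, is invertible (Thm. 7.3 ⇐) and `Λ_1L = Λ_1`.
[cite: HertlingLarabi2026, §8 Thm. 8.2 (b) proof Step 2 («consider the full lattice L := ⋂ a_p(Λ_2)_(p) … By Theorem 7.3 L ∈ G(Λ_2) … so L ∈ ker(G(Λ_2) → G(Λ_1))»), chunk p0022] -/
theorem exists_mem_ker_forall_prime_locEq {Λ₁ Λ₂ : Submodule ℤ A} (h1 : (1 : A) ∈ Λ₁)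
    (hΛ₁Λ₁ : Λ₁ * Λ₁ ≤ Λ₁) (hΛ₂ : IsFullLattice A Λ₂) (h2 : (1 : A) ∈ Λ₂)
    (hΛ₂Λ₂ : Λ₂ * Λ₂ ≤ Λ₂) (hle : Λ₂ ≤ Λ₁) (a : ℕ → Aˣ) (P₀ : Finset ℕ) (ha : ∀ p ∉ P₀, a p = 1)
    (haΛ₁ : ∀ p, (a p : A) ∈ Λ₁)
    (hunit : ∀ p : ℕ, p.Prime → ∃ b ∈ Λ₁, ∃ r : ℤ, ¬ (p : ℤ) ∣ r ∧ (a p : A) * b = r • (1 : A)) :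
    ∃ M : Submodule ℤ A, IsFullLattice A M ∧ M / M = Λ₂ ∧ M * ((M / M) / M) = M / M ∧
      Λ₁ * M = Λ₁ ∧ ∀ p : ℕ, p.Prime → ∃ s : ℤ, ¬ (p : ℤ) ∣ s ∧
        (∀ x ∈ M, s • x ∈ a p • Λ₂) ∧ (∀ x ∈ a p • Λ₂, s • x ∈ M) := by
  obtain ⟨M, hM, hMU⟩ := exists_isFullLattice_forall_prime_locEq hΛ₂ (U := fun p => a p • Λ₂)
    (fun p => IsFullLattice.units_smul _ hΛ₂) P₀ (fun p hp => by simp only [ha p hp, one_smul])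
  have hΛ₂O : Λ₂ / Λ₂ = Λ₂ := div_self_eq_of_one_mem h2 hΛ₂Λ₂
  have hO : M / M = Λ₂ := eq_of_forall_prime_locEq fun p hp => by
    have h := locEq_div hp (hMU p hp) (hMU p hp)
    rwa [div_self_units_smul, hΛ₂O] at h
  have hinv : M * ((M / M) / M) = M / M :=
    mul_div_div_eq_of_forall_prime_locEq_units_smul hM a P₀ ha fun p hp => by rw [hO]; exact hMU p hp
  exact ⟨M, hM, hO, hinv, (order_mul_eq_iff_forall_prime_exists_localUnit_locEq h1 hΛ₁Λ₁ h2 hle hM hO hinv).2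
    fun p hp => ⟨a p, haΛ₁ p, hunit p hp, hMU p hp⟩, hMU⟩

/-! ## §4 Theorem 8.2 (d): `C + aΛ_2 ∈ ker(G(Λ_2) → G(Λ_1))` for `a + C ∈ (Λ_1/C)^{unit}` -/

omit [Algebra ℚ A] in
/-- `aΛ_2`, written `Λ_2.map (mulLeft a)`, is `a • Λ_2` when `a` is a unit of `A`. [folklore] -/
private theorem map_mulLeft_eq_units_smul (a : Aˣ) (M : Submodule ℤ A) :
    M.map (LinearMap.mulLeft ℤ (a : A)) = a • M := by
  ext x
  rw [Submodule.mem_map, Units.smul_def, Submodule.mem_smul_pointwise_iff_exists]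
  simp only [LinearMap.mulLeft_apply, smul_eq_mul]

/-- **THEOREM 8.2 (d), the local generators: for orders `Λ_2 ⊆ Λ_1`, the conductor `C = Λ_2:Λ_1` and `a ∈ Λ_1` with
`a + C ∈ (Λ_1/C)^{unit}` (`aã − 1 ∈ C` for some `ã ∈ Λ_1`), at every prime `p` there is
`d_p ∈ (a + C) ∩ (Λ_1)_(p)^{unit}` (Thm. 7.6 (b)) and `(C + aΛ_2)_(p) = d_p(Λ_2)_(p)`** («`(C + aΛ_2)_(p) =
(C + d_pΛ_2)_(p) = C_(p) + d_p(Λ_2)_(p) = d_pC_(p) + d_p(Λ_2)_(p) = d_p(C + Λ_2)_(p) = d_p(Λ_2)_(p)`» — valid for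
EVERY `p`, not only `p ∈ P_0`). [cite: HertlingLarabi2026, §8 Thm. 8.2 (d) proof, chunk p0022] -/
theorem exists_localUnit_locEq_conductor_sup_map_mulLeft {Λ₁ Λ₂ : Submodule ℤ A}
    (hΛ₁ : IsFullLattice A Λ₁) (h1 : (1 : A) ∈ Λ₁) (hΛ₁Λ₁ : Λ₁ * Λ₁ ≤ Λ₁)
    (hle : Λ₂ ≤ Λ₁) {a a' : A} (ha : a ∈ Λ₁) (ha' : a' ∈ Λ₁)
    (haa' : a * a' - 1 ∈ Λ₂ / Λ₁) {p : ℕ} (hp : p.Prime) :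
    ∃ d : Aˣ, (d : A) ∈ Λ₁ ∧ (d : A) - a ∈ Λ₂ / Λ₁ ∧
      (∃ b ∈ Λ₁, ∃ r : ℤ, ¬ (p : ℤ) ∣ r ∧ (d : A) * b = r • (1 : A)) ∧
      ∃ s : ℤ, ¬ (p : ℤ) ∣ s ∧
        (∀ x ∈ Λ₂ / Λ₁ ⊔ Λ₂.map (LinearMap.mulLeft ℤ a), s • x ∈ d • Λ₂) ∧
        (∀ x ∈ d • Λ₂, s • x ∈ Λ₂ / Λ₁ ⊔ Λ₂.map (LinearMap.mulLeft ℤ a)) := by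
  have hCΛ₂ : Λ₂ / Λ₁ ≤ Λ₂ := conductor_le h1
  have hΛ₁C : Λ₁ * (Λ₂ / Λ₁) = Λ₂ / Λ₁ :=
    le_antisymm (conductor_mul_le h1 hΛ₁Λ₁) fun x hx => by rw [← one_mul x]; exact Submodule.mul_mem_mul h1 hx
  have hs1 : ¬ (p : ℤ) ∣ 1 := fun h => hp.ne_one (by exact_mod_cast Int.eq_one_of_dvd_one (by positivity) h)
  -- Theorem 7.6 (b): `d = a + l ∈ (a + C) ∩ (Λ₁)_(p)^unit`
  obtain ⟨l, hlC, b, hb, r, hr, hd⟩ := exists_add_mem_mul_eq_smul_one hΛ₁ h1 hΛ₁Λ₁ (hCΛ₂.trans hle)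
    (conductor_mul_le h1 hΛ₁Λ₁) hp ha ha' hs1 (by rwa [one_smul])
  have hr0 : r ≠ 0 := fun h => hr (h ▸ dvd_zero _)
  have hdU : IsUnit (a + l) := isUnit_of_mul_eq_smul_one hr0 hd
  have hdΛ₁ : a + l ∈ Λ₁ := Λ₁.add_mem ha (hle (hCΛ₂ hlC))
  refine ⟨hdU.unit, hdΛ₁, by rw [IsUnit.unit_spec, add_sub_cancel_left]; exact hlC, ⟨b, hb, r, hr, hd⟩, ?_⟩
  -- `C + aΛ₂ = C + dΛ₂`
  have hCmul : ∀ c ∈ Λ₂ / Λ₁, ∀ y ∈ Λ₂, c * y ∈ Λ₂ / Λ₁ := fun c hc y hy => by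
    rw [mul_comm, ← hΛ₁C]
    exact Submodule.mul_mem_mul (hle hy) hc
  have hN : Λ₂ / Λ₁ ⊔ Λ₂.map (LinearMap.mulLeft ℤ a) = Λ₂ / Λ₁ ⊔ Λ₂.map (LinearMap.mulLeft ℤ (a + l)) := by
    refine le_antisymm (sup_le le_sup_left ?_) (sup_le le_sup_left ?_)
    · rintro _ ⟨y, hy, rfl⟩
      have e : LinearMap.mulLeft ℤ a y = (a + l) * y - l * y := by rw [LinearMap.mulLeft_apply]; ring
      rw [e]
      exact Submodule.sub_mem _ (Submodule.mem_sup_right ⟨y, hy, rfl⟩) (Submodule.mem_sup_left (hCmul l hlC y hy))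
    · rintro _ ⟨y, hy, rfl⟩
      have e : LinearMap.mulLeft ℤ (a + l) y = a * y + l * y := by rw [LinearMap.mulLeft_apply]; ring
      rw [e]
      exact Submodule.add_mem _ (Submodule.mem_sup_right ⟨y, hy, rfl⟩) (Submodule.mem_sup_left (hCmul l hlC y hy))
  have hmap : Λ₂.map (LinearMap.mulLeft ℤ (a + l)) = hdU.unit • Λ₂ := by
    rw [← map_mulLeft_eq_units_smul, IsUnit.unit_spec]
  rw [hN, hmap]
  -- `C_(p) = d·C_(p)` (as `(Λ₁)_(p) = d(Λ₁)_(p)` and `C = Λ₁C`), so `(C + dΛ₂)_(p) = d(C + Λ₂)_(p) = d(Λ₂)_(p)`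
  have hΛ₁loc := locEq_units_smul_of_mul_eq_smul_one hΛ₁Λ₁ hdΛ₁ hb hr hd hdU
  have hCloc := locEq_mul hp hΛ₁loc (locEq_refl hp (Λ₂ / Λ₁))
  rw [← units_smul_mul, hΛ₁C] at hCloc
  have hsup : hdU.unit • (Λ₂ / Λ₁) ⊔ hdU.unit • Λ₂ = hdU.unit • Λ₂ := by
    refine le_antisymm (sup_le (fun x hx => ?_) le_rfl) le_sup_right
    rw [mem_units_smul_submodule_iff] at hx ⊢
    exact hCΛ₂ hx
  have h := locEq_sup hp hCloc (locEq_refl hp (hdU.unit • Λ₂))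
  rwa [hsup] at h

/-- **THEOREM 8.2 (d) (8.6): for orders `Λ_2 ⊆ Λ_1` of `A`, `C = Λ_2:Λ_1`, and `a ∈ Λ_1` with `a + C ∈ (Λ_1/C)^{unit}`,
the lattice `C + aΛ_2` lies in `ker(G(Λ_2) → G(Λ_1))`: it is a full lattice with exact order `Λ_2`, invertible,
and `Λ_1(C + aΛ_2) = Λ_1`** (the map `((a + C) mod (Λ_2/C)^{unit}) ↦ C + aΛ_2` of (8.6) is well defined; its
bijectivity onto the kernel, HL's parts (c)–(d), is not formalised here).
[cite: HertlingLarabi2026, §8 Thm. 8.2 (d) («… is given by ((a+C) mod (Λ_2/C)^unit) ↦ C + aΛ_2, where a ∈ Λ_1, a + C ∈ (Λ_1/C)^unit»; proof: «L = ⋂(C + aΛ_2)_(p) = C + aΛ_2»), chunks p0021–p0022]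
[cite: NeukirchANT1999, I §12 Prop. (12.9) (one field: the connecting map `⊕_𝔭 𝒪_{K,𝔭}^*/𝒪_𝔭^* → Pic(𝒪)`)] -/
theorem conductor_sup_map_mulLeft_mem_ker {Λ₁ Λ₂ : Submodule ℤ A}
    (hΛ₁ : IsFullLattice A Λ₁) (h1 : (1 : A) ∈ Λ₁) (hΛ₁Λ₁ : Λ₁ * Λ₁ ≤ Λ₁)
    (hΛ₂ : IsFullLattice A Λ₂) (h2 : (1 : A) ∈ Λ₂) (hΛ₂Λ₂ : Λ₂ * Λ₂ ≤ Λ₂) (hle : Λ₂ ≤ Λ₁)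
    {a a' : A} (ha : a ∈ Λ₁) (ha' : a' ∈ Λ₁) (haa' : a * a' - 1 ∈ Λ₂ / Λ₁) :
    IsFullLattice A (Λ₂ / Λ₁ ⊔ Λ₂.map (LinearMap.mulLeft ℤ a)) ∧
      (Λ₂ / Λ₁ ⊔ Λ₂.map (LinearMap.mulLeft ℤ a)) / (Λ₂ / Λ₁ ⊔ Λ₂.map (LinearMap.mulLeft ℤ a)) = Λ₂ ∧
      (Λ₂ / Λ₁ ⊔ Λ₂.map (LinearMap.mulLeft ℤ a)) *
          (((Λ₂ / Λ₁ ⊔ Λ₂.map (LinearMap.mulLeft ℤ a)) / (Λ₂ / Λ₁ ⊔ Λ₂.map (LinearMap.mulLeft ℤ a))) /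
            (Λ₂ / Λ₁ ⊔ Λ₂.map (LinearMap.mulLeft ℤ a))) =
        (Λ₂ / Λ₁ ⊔ Λ₂.map (LinearMap.mulLeft ℤ a)) / (Λ₂ / Λ₁ ⊔ Λ₂.map (LinearMap.mulLeft ℤ a)) ∧
      Λ₁ * (Λ₂ / Λ₁ ⊔ Λ₂.map (LinearMap.mulLeft ℤ a)) = Λ₁ := by
  have hC : IsFullLattice A (Λ₂ / Λ₁) := isFullLattice_div hΛ₂ hΛ₁
  have hloc := fun (p : ℕ) (hp : p.Prime) =>
    exists_localUnit_locEq_conductor_sup_map_mulLeft hΛ₁ h1 hΛ₁Λ₁ hle ha ha' haa' hp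
  -- full: finitely generated and `⊇ C`
  have hN : IsFullLattice A (Λ₂ / Λ₁ ⊔ Λ₂.map (LinearMap.mulLeft ℤ a)) :=
    ⟨hC.1.sup (hΛ₂.1.map _), fun d => by
      obtain ⟨n, hn, hnd⟩ := hC.2 d
      exact ⟨n, hn, Submodule.mem_sup_left hnd⟩⟩
  have hΛ₂O : Λ₂ / Λ₂ = Λ₂ := div_self_eq_of_one_mem h2 hΛ₂Λ₂
  -- exact order `Λ₂`: `𝒪(N)_(p) = 𝒪(d_pΛ₂)_(p) = (Λ₂)_(p)`
  have hO : (Λ₂ / Λ₁ ⊔ Λ₂.map (LinearMap.mulLeft ℤ a)) / (Λ₂ / Λ₁ ⊔ Λ₂.map (LinearMap.mulLeft ℤ a)) = Λ₂ :=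
    eq_of_forall_prime_locEq fun p hp => by
      obtain ⟨d, -, -, -, hl⟩ := hloc p hp
      have h := locEq_div hp hl hl
      rwa [div_self_units_smul, hΛ₂O] at h
  -- invertible: locally principal (Thm. 7.3 ⇐, pointwise form)
  have hinv := (mul_div_div_eq_iff_forall_prime_exists_units_locEq hN).2 fun p hp => by
    obtain ⟨d, -, -, -, hl⟩ := hloc p hp
    rw [hO]
    exact ⟨d, hl⟩
  refine ⟨hN, hO, hinv, ?_⟩
  exact (order_mul_eq_iff_forall_prime_exists_localUnit_locEq h1 hΛ₁Λ₁ h2 hle hN hO hinv).2 fun p hp => by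
    obtain ⟨d, hdΛ₁, -, hunit, hl⟩ := hloc p hp
    exact ⟨d, hdΛ₁, hunit, hl⟩

omit [Algebra ℚ A] in
/-- **THEOREM 8.2 (d), the claim (8.12): `(a + C)Λ_1 = Λ_1` for `a + C ∈ (Λ_1/C)^{unit}`** («An element `ã ∈ Λ` with
`(a + C)(ã + C) = 1_A + C` exists. Then `Λ_1 ⊃ (a + C)Λ_1 ⊃ (a + C)(ã + C)Λ_1 = (1_A + C)Λ_1 = Λ_1`»), here as
`C + aΛ_1 = Λ_1`. [cite: HertlingLarabi2026, §8 Thm. 8.2 (d) proof, claim (8.12), chunk p0022] -/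
theorem conductor_sup_map_mulLeft_order_eq {Λ₁ Λ₂ : Submodule ℤ A} (h1 : (1 : A) ∈ Λ₁)
    (hΛ₁Λ₁ : Λ₁ * Λ₁ ≤ Λ₁) (hle : Λ₂ ≤ Λ₁) {a a' : A} (ha : a ∈ Λ₁) (ha' : a' ∈ Λ₁)
    (haa' : a * a' - 1 ∈ Λ₂ / Λ₁) :
    Λ₂ / Λ₁ ⊔ Λ₁.map (LinearMap.mulLeft ℤ a) = Λ₁ := by
  have hCΛ₁ : Λ₂ / Λ₁ ≤ Λ₁ := (conductor_le h1).trans hle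
  refine le_antisymm (sup_le hCΛ₁ ?_) fun x hx => ?_
  · rintro _ ⟨y, hy, rfl⟩
    rw [LinearMap.mulLeft_apply]
    exact hΛ₁Λ₁ (Submodule.mul_mem_mul ha hy)
  · -- `x = a(a'x) − (aa' − 1)x`
    have e : x = LinearMap.mulLeft ℤ a (a' * x) - (a * a' - 1) * x := by rw [LinearMap.mulLeft_apply]; ring
    rw [e]
    refine Submodule.sub_mem _ (Submodule.mem_sup_right ⟨a' * x, hΛ₁Λ₁ (Submodule.mul_mem_mul ha' hx), rfl⟩)
      (Submodule.mem_sup_left ?_)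
    have h := conductor_mul_le h1 hΛ₁Λ₁ (Submodule.mul_mem_mul hx haa')
    rwa [mul_comm] at h

end OrderExtensionKernel

end Literature.NumberTheory.ComplexMultiplication.FiniteQAlgebraLattice
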